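import Summits.CriticalPhenomena.PercolationContinuityZ3.Theorems.PercNearOneGluingNoHeavyRsw3InvasionOneEnded
import Literature.Probability.Percolation.WiredMinimalSpanningForest
import Literature.Barriers.CriticalPhenomena.SubexponentialGrowthZdCoupling
import HarnessLib

/-!
# RSW3 lane (P2, gen 29): INVASION PERCOLATION XXXIV — THE WIRED MINIMAL SPANNING FOREST IS THE UNION OF THE INVASION TREES
# (Lyons–Peres–Schramm 2006, Prop. 3.3, every infinite connected locally finite graph, injective labels); on `ℤ^d` (`d ≥ 2`, p205010) the WMSF is
# a.s. the union of the invasion trees, the origin's one being ONE-ENDED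

builds on p205010 (kernel theorem, internal audit signed; external expert review pending) — used only in `ae_wmsf_eq_iUnion_and_oneEnded` (through file XXX).

Cell `prim-rsw3`, prover seat `prim-rsw3-p2` (gen 29), memo `run/shared/lean/prim/rsw3/P2-RSWLITE.md` §36.  Support file
(`--supports stmt-CriticalPhenomena-4575`); no definitions, no named facts, no sorries.  `wmsf G U` = the finite-cut form of LPS's `𝔉_w(U)`
(`Literature/Probability/Percolation/WiredMinimalSpanningForest.lean`: `e ∈ wmsf G U` iff some finite `W` has `e` as the STRICTLY least bond of its edge boundary);
`treeEdges G U x` = the bonds of the invasion tree `T_U(x)`.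

* `treeEdges_subset_wmsf` — for labels injective on the bonds of `G`, every invasion tree lies in the WMSF (the bond absorbed at step `n` is the least boundary bond
  of the finite set `I_n`).
* **`exists_mem_treeEdges_of_mem_wmsf`** — on an infinite connected graph (no injectivity needed), every WMSF bond `e` (least boundary bond of a finite `W`) is absorbed
  by the invasion started at its inner endpoint: that invasion leaves `W` for the first time through a boundary bond of `W` of label `≤ U e` (because `e` itself is on the
  boundary of the invaded region all along), hence through `e`.
* **`iUnion_treeEdges_eq_wmsf`** — LPS06 PROPOSITION 3.3: `⋃_x T_U(x) = 𝔉_w(U)` for injective labels.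
* `ae_iUnion_treeEdges_eq_wmsf` (`ℤ^d`, `d ≥ 1`; labels are a.s. injective) and **`ae_wmsf_eq_iUnion_and_oneEnded`** (`d ≥ 2`, p205010): a.s. the WMSF of `ℤ^d` is the union
  of the invasion trees AND the invasion tree of the origin — a subtree of the WMSF through `0` — has one end (file XXX).  NOT claimed: that every COMPONENT of the
  WMSF has one end (LPS06 Thm 3.12 in full needs Prop. 3.4/11.5 and a mass-transport step; recorded for a successor).

References: R. Lyons, Y. Peres, O. Schramm, Ann. Probab. 34 (2006) 1665–1692, §3 p. 1671 and Prop. 3.3 [LyonsPeresSchramm2006]; R. Lyons, Y. Peres (2016) §11.2,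
Exercises 11.5 and 11.7 [LyonsPeres2016].
-/

noncomputable section

namespace Summit.CriticalPhenomena.PercolationContinuityZ3.Theorems.Rsw3

open Finset Filter MeasureTheory Literature.Probability.LatticeModels Literature.Probability.Percolation Literature.Probability.Percolation.Invasion

section General

variable {V : Type*} [DecidableEq V] {G : SimpleGraph V} [G.LocallyFinite]

/-- **Every invasion tree lies in the WMSF** (labels injective on the bonds of `G`): the bond absorbed at step `n` is the strictly least boundary bond of the finite
invaded region `I_n`. [cite: LyonsPeresSchramm2006, Prop. 3.3 (proof)] -/
theorem treeEdges_subset_wmsf {U : Sym2 V → ℝ} (hU : Set.InjOn U G.edgeSet) (o : V) : treeEdges G U o ⊆ wmsf G U := by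
  rintro e ⟨n, a, ha, rfl⟩
  have haB : a ∈ boundaryDarts G (invasion G U o n) := ((mem_minDarts G).1 (newDart_mem G ha)).1
  refine ⟨invasion G U o n, a, haB, rfl, fun b hb hne => lt_of_le_of_ne (label_newDart_le ha hb) fun heq => hne ?_⟩
  have haE : s(a.1, a.2) ∈ G.edgeSet := (adj_of_newDart ha)
  have hbE : s(b.1, b.2) ∈ G.edgeSet := ((mem_boundaryDarts G).1 hb).2.2
  exact (hU haE hbE heq).symm

/-- **Every WMSF bond is absorbed by the invasion from its inner endpoint** (infinite connected locally finite graph, ANY labels): if `e = s(a.1, a.2)` is the strictly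
least boundary bond of a finite `W ∋ a.1`, `a.2 ∉ W`, then the invasion from `a.1` exits `W` for the first time along `e`, so `e ∈ T_U(a.1)`.
[cite: LyonsPeresSchramm2006, Prop. 3.3 (proof)] -/
theorem exists_mem_treeEdges_of_mem_wmsf [Infinite V] (hG : G.Preconnected) {U : Sym2 V → ℝ} {e : Sym2 V} (he : e ∈ wmsf G U) :
    ∃ x, e ∈ treeEdges G U x := by
  classical
  obtain ⟨W, a, haW, hae, hmin⟩ := he
  obtain ⟨ha1, ha2, hadj⟩ := (mem_boundaryDarts G).1 haW
  refine ⟨a.1, ?_⟩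
  -- the first exit time of the invasion from `a.1` out of `W`
  have hex : ∃ n, ¬ invasion G U a.1 n ⊆ W := exists_not_subset_invasion hG U a.1 W
  have hN0 : Nat.find hex ≠ 0 := by
    intro h0
    have h := Nat.find_spec hex
    rw [h0, invasion_zero] at h
    exact h (Finset.singleton_subset_iff.2 ha1)
  obtain ⟨M, hM⟩ := Nat.exists_eq_succ_of_ne_zero hN0
  have hMin : invasion G U a.1 M ⊆ W := not_not.1 (Nat.find_min hex (by omega))
  have hMout : ¬ invasion G U a.1 (M + 1) ⊆ W := by
    have h := Nat.find_spec hex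
    rw [hM] at h
    exact h
  -- a dart `c` is absorbed at step `M`, and it exits `W`
  cases hd : newDart G U (invasion G U a.1 M) with
  | none =>
    rw [invasion_succ, step_of_eq_none G hd] at hMout
    exact absurd hMin hMout
  | some c =>
    rw [invasion_succ_of_newDart hd] at hMout
    have hc2 : c.2 ∉ W := fun h => hMout (Finset.insert_subset h hMin)
    have hcW : c ∈ boundaryDarts G W := (mem_boundaryDarts G).2 ⟨hMin (fst_mem_of_newDart hd), hc2, adj_of_newDart hd⟩
    -- `a` is a boundary dart of `I_M` (root inside, `a.2 ∉ W ⊇ I_M`), so the greedy rule gives `U s(c) ≤ U s(a) = U e`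
    have haI : a ∈ boundaryDarts G (invasion G U a.1 M) :=
      (mem_boundaryDarts G).2 ⟨root_mem_invasion U a.1 M, fun h => ha2 (hMin h), hadj⟩
    have hle : U s(c.1, c.2) ≤ U s(a.1, a.2) := label_newDart_le hd haI
    have hce : s(c.1, c.2) = e := by
      by_contra hne
      have hlt := hmin c hcW hne
      rw [← hae] at hlt
      exact absurd hle (not_le.2 hlt)
    exact ⟨M, c, hd, hce⟩

/-- **Lyons–Peres–Schramm 2006, PROPOSITION 3.3: the WMSF is the union of the invasion trees** — `⋃_x T_U(x) = 𝔉_w(U)` on every infinite connected locally finite graph,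
for labels injective on the bonds. [cite: LyonsPeresSchramm2006, Prop. 3.3] -/
theorem iUnion_treeEdges_eq_wmsf [Infinite V] (hG : G.Preconnected) {U : Sym2 V → ℝ} (hU : Set.InjOn U G.edgeSet) :
    (⋃ x, treeEdges G U x) = wmsf G U := by
  refine Set.Subset.antisymm (Set.iUnion_subset fun x => treeEdges_subset_wmsf hU x) fun e he => ?_
  obtain ⟨x, hx⟩ := exists_mem_treeEdges_of_mem_wmsf hG he
  exact Set.mem_iUnion.2 ⟨x, hx⟩

end General

/-! ## `ℤ^d` -/

variable {d : ℕ}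

/-- **On `ℤ^d` (`d ≥ 1`) the WMSF is a.s. the union of the invasion trees** (labels are a.s. injective). [cite: LyonsPeresSchramm2006, Prop. 3.3] -/
theorem ae_iUnion_treeEdges_eq_wmsf (hd : 1 ≤ d) :
    ∀ᵐ U ∂(labelMeasure (Site d)), (⋃ x, treeEdges (zdGraph d) U x) = wmsf (zdGraph d) U := by
  haveI : Nonempty (Fin d) := ⟨⟨0, hd⟩⟩
  haveI : Infinite (Site d) := Pi.infinite_of_right
  filter_upwards [Literature.Barriers.CriticalPhenomena.ae_injective_labelMeasure (V := Site d)] with U hU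
  exact iUnion_treeEdges_eq_wmsf zdGraph_preconnected_holds (hU.injOn)

/-- **WMSF of `ℤ^d`, `d ≥ 2` (p205010): a.s. the union of the invasion trees, with the origin's invasion tree — a subtree of the WMSF containing the origin's edges —
ONE-ENDED** (any two self-avoiding rays of `T_U(0)` from `0` share edges beyond every index).  The full Lyons–Peres–Schramm Thm 3.12 (every WMSF component one-ended)
is not claimed here. [cite: LyonsPeresSchramm2006, Prop. 3.3 and Thm. 3.12 (proof, first paragraph)] -/
theorem ae_wmsf_eq_iUnion_and_oneEnded (hd : 2 ≤ d) :
    ∀ᵐ U ∂(labelMeasure (Site d)), (⋃ x, treeEdges (zdGraph d) U x) = wmsf (zdGraph d) U ∧ treeEdges (zdGraph d) U 0 ⊆ wmsf (zdGraph d) U ∧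
      ∀ r r' : ℕ → Site d, Function.Injective r → Function.Injective r' → r 0 = 0 → r' 0 = 0 →
        (∀ i, (tree (zdGraph d) U 0).Adj (r i) (r (i + 1))) → (∀ i, (tree (zdGraph d) U 0).Adj (r' i) (r' (i + 1))) →
        ∀ N, ∃ i i', N ≤ i ∧ r i = r' i' ∧ r (i + 1) = r' (i' + 1) := by
  filter_upwards [ae_iUnion_treeEdges_eq_wmsf (d := d) (by omega), ae_invasionTree_oneEnded hd] with U h1 h2
  exact ⟨h1, h1 ▸ Set.subset_iUnion (fun x => treeEdges (zdGraph d) U x) 0, h2⟩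

end Summit.CriticalPhenomena.PercolationContinuityZ3.Theorems.Rsw3
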